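import Summits.AtomisticToContinuum.HydrodynamicLimit.Theorems.OneFlightGossipEngineEnergyCurrentTailsMixingFloorRung0
import HarnessLib

/-!
# Crux `EnergyCurrentTails` (stmt-AtomisticToContinuum-9235), line `quartic-schur-ledger`:
# rung-0 certificate of the thermal-rate quartic mixing floor QMF₄ (`stub_quarticMixingFloor4Rung0`)

Stub worker file for the registered audit stub `stub_quarticMixingFloor4Rung0` of the line lead's
skeleton `Cruxes/EnergyCurrentTails/Lines/quartic_schur_ledger.lean` (primary crux decl
`Summit.AtomisticToContinuum.HydrodynamicLimit.Theses.WarmColdDichotomy.EnergyCurrentTails`).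

**Statement.**  At GLOBAL EQUILIBRIUM with drift (`G_N = localGibbsLaw σ a u θ̄ N (Φ N)`, constant
profiles `a, θ̄ > 0`, drift `u`), for `0 < σ < σ₀` and every flow family there are `N`-independent
`K₀ ≥ 0`, `c > 0` and `N₀` with, for all `N ≥ N₀` and ALL windows `0 ≤ s ≤ t`,
`ofReal(c σ²(N+1)^{1/3}) ∫_{(s,t]} E_G[(N+1)⁻¹ Σᵢ 𝟙{K₀ < ‖vᵢ(τ)‖} ‖vᵢ(τ)‖⁴] dτ
   ≤ E_G[Σ_{collisions in (s,t]} Σ_{ordered contact pairs (i,j)} 𝟙{K₀ < ‖vᵢ⁻‖} (N+1)⁻¹ 2‖vᵢ⁺‖²‖vⱼ⁺‖²]`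
(the thermal-rate quartic mixing floor QMF₄ `stub_quarticMixingFloor4` at constant profiles, without
horizon).  It is the QMF rung-0 certificate `stub_quarticMixingFloorRung0` with the constant Gaussian
FOURTH moment on the left instead of the fifth.

**Proof.**  Identical to `stub_quarticMixingFloorRung0` (whose one-collision / pathwise / expected
comparison lemmas `c5qmf_guard_pair_le`, `c5qmf_eventSum_le`, `c5qmf_eventCount_le` are reused by name):
LEFT `= ofReal(c κ_N) · m · (t − s)`, `m ≤ m₄ = E‖w‖⁴ < ∞` (invariance and one-body marginal,
`avgMoment_flow_localGibbsLaw_drift`, `lintegral_norm_pow_gaussMeasure_ne_top`).  RIGHT: `K₀ = √E` at the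
level `E = max(E_th, 1)` of seat c2's landed splitting floor `stub_splitFloorRung0`;
`eventCount(splitEvent E) ≤ Thin + ofReal((N+1)/(ηE²)) · RIGHT` (`c5qmf_eventCount_le`), the thin count
`≤ ofReal(X/2)` (flux ceiling `c5sd_lintegral_collisionPairSum_le`, `c5sd_tendsto_thinFlux`), the floor
`ofReal X ≤ eventCount` (`stub_splitFloorRung0`, `shellCensus_const`), `X = c₂ √E γ_shell (N+1)² ε² (t−s)`;
whence `RIGHT ≥ ofReal(κ₀ (N+1)ε²(t−s))`, `κ₀ = c₂ √E γ_shell ηE²/2`, and `c := κ₀/(E‖w‖⁴ + 1)`,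
`N₀ := max N₃ 1`, read on the routes' inline form (`c5sd_finsum_eq_collisionPairSum`).

References: Cercignani–Illner–Pulvirenti 1994 §2.2, §4.2, App. 4.A; Gallagher–Saint-Raymond–Texier
2013, Prop. 4.1.1; Ruelle 1969 §4.2.
-/

noncomputable section

open MeasureTheory Set Filter Topology
open scoped ENNReal InnerProductSpace

namespace Summit.AtomisticToContinuum.HydrodynamicLimit.Theorems.QuarticSchurLedger

open Literature.MathematicalPhysics.KineticTheory Literature.Analysis.FluidPDE
open Literature.Analysis.FunctionSpaces
open Summit.AtomisticToContinuum.HydrodynamicLimit.Theorems.EnergyCurrentTailsLevelCensus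

/-! ### The certificate -/

/-- **Audit stub `stub_quarticMixingFloor4Rung0` — QMF₄ at rung 0 (global equilibrium with drift),
uniformly in `N ≥ N₀` and in the window.**  For constant profiles `a, θ̄ > 0`, drift `u`, there is
`σ₀ > 0` such that for `0 < σ < σ₀` and every flow family there are `K₀ ≥ 0`, `c > 0`, `N₀` with, for all
`N ≥ N₀` and `0 ≤ s ≤ t`,
`ofReal(c σ²(N+1)^{1/3}) ∫_{(s,t]} E_G[(N+1)⁻¹Σᵢ 𝟙{K₀<‖vᵢ(τ)‖}‖vᵢ(τ)‖⁴] dτ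
   ≤ E_G[Σ_{coll ∈ (s,t]} Σ_{(i,j)} 𝟙{K₀<‖vᵢ⁻‖}(N+1)⁻¹ 2‖vᵢ⁺‖²‖vⱼ⁺‖²]`.
Proof: LEFT `= ofReal(c κ_N) · E_{N(u,θ̄)}[𝟙{K₀<‖w‖}‖w‖⁴] · (t−s) ≤ … E‖w‖⁴` (stationarity and one-body
marginal, `avgMoment_flow_localGibbsLaw_drift`); RIGHT: with `K₀ = √E`, `E = max(E_th, 1)`,
`eventCount(splitEvent E) ≤ Thin + ofReal((N+1)/(ηE²)) · RIGHT` (`c5qmf_eventCount_le`), the thin count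
`≤ ofReal(X/2)` by the flux ceiling and the choice of `η` (`c5sd_lintegral_collisionPairSum_le`,
`c5sd_tendsto_thinFlux`), the floor `ofReal X ≤ eventCount` (`stub_splitFloorRung0`, `shellCensus_const`),
`X = c₂ √E γ_shell (N+1)² ε² (t−s)`; whence `RIGHT ≥ ofReal(κ₀ (N+1)ε²(t−s))` and
`c := κ₀/(E‖w‖⁴ + 1)`, read on the routes' inline form (`c5sd_finsum_eq_collisionPairSum`). [folklore] -/
theorem stub_quarticMixingFloor4Rung0 :
    ∀ (a θb : ℝ) (u : V3), 0 < a → 0 < θb →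
      ∃ σ₀ : ℝ, 0 < σ₀ ∧ ∀ σ : ℝ, 0 < σ → σ < σ₀ →
        ∀ Φ : ((N : ℕ) → HardSphereFlow (Torus.geometry (Fin 3)) (hsDiameter σ N) (N + 1)),
          ∃ K₀ : ℝ, 0 ≤ K₀ ∧ ∃ c : ℝ, 0 < c ∧ ∃ N₀ : ℕ, ∀ N : ℕ, N₀ ≤ N →
            ∀ s t : ℝ, 0 ≤ s → s ≤ t →
              ENNReal.ofReal (c * (σ ^ 2 * ((N + 1 : ℕ) : ℝ) ^ ((1 : ℝ) / 3))) *
                  ∫⁻ τ in Set.Ioc s t, (∫⁻ z, ENNReal.ofReal (((N + 1 : ℕ) : ℝ)⁻¹ *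
                    ∑ i : Fin (N + 1), if K₀ < ‖(((Φ N).flow τ z) i).2‖ then
                      ‖(((Φ N).flow τ z) i).2‖ ^ 4 else 0) ∂(localGibbsLaw σ (fun _ => a) (fun _ => u) (fun _ => θb) N (Φ N))) ≤
                ∫⁻ z, (∑ᶠ τ ∈ collisionTimes (Torus.geometry (Fin 3)) (hsDiameter σ N)
                    (fun r => (Φ N).flow r z) ∩ Set.Ioc s t,
                  ∑ i : Fin (N + 1), ∑ j : Fin (N + 1), if i = j then (0 : ℝ≥0∞) else
                    (contactSet (Torus.geometry (Fin 3)) (N + 1) (hsDiameter σ N) i j).indicator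
                      (fun y => if K₀ < ‖((collidePair (Torus.geometry (Fin 3)) i j y) i).2‖ then
                        ENNReal.ofReal (((N + 1 : ℕ) : ℝ)⁻¹ *
                          (2 * (‖(y i).2‖ ^ 2 * ‖(y j).2‖ ^ 2))) else 0)
                      ((Φ N).flow τ z)) ∂(localGibbsLaw σ (fun _ => a) (fun _ => u) (fun _ => θb) N (Φ N)) := by
  intro a θb u ha hθ
  obtain ⟨σA, hσA, hsmallA⟩ := exists_smallDensity uniformProfile one_pos
  obtain ⟨σB, hσB, hfloorB⟩ := stub_splitFloorRung0 a θb u ha hθ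
  refine ⟨min σA σB, lt_min hσA hσB, fun σ hσ hσlt Φ => ?_⟩
  have hsm : SmallDensity uniformProfile σ := (hsmallA σ hσ (hσlt.trans_le (min_le_left _ _))).1
  have hσ2 : σ < 1 / 2 := hsm.σ_lt_half
  obtain ⟨cs, hcs, Eth, N₃, hfloor⟩ := hfloorB σ hσ (hσlt.trans_le (min_le_right _ _)) Φ
  -- the level `E` (threshold `K₀ = √E`) and the Gaussian constants
  set E : ℝ := max Eth 1 with hEdef
  have hE : 0 < E := lt_of_lt_of_le one_pos (le_max_right _ _)
  have hEth : Eth ≤ E := le_max_left _ _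
  set γS : ℝ≥0∞ := gaussMeasure u θb {v : V3 | E < ‖v‖ ^ 2 ∧ ‖v‖ ^ 2 ≤ 3 / 2 * E} with hγSdef
  have hγS0 : γS ≠ 0 := c5sd_gaussMeasure_shell_ne_zero u hθ hE
  have hγStop : γS ≠ ⊤ := measure_ne_top _ _
  set gS : ℝ := γS.toReal with hgSdef
  have hgS : 0 < gS := ENNReal.toReal_pos hγS0 hγStop
  have hγSeq : γS = ENNReal.ofReal gS := (ENNReal.ofReal_toReal hγStop).symm
  set m₄ : ℝ≥0∞ := ∫⁻ w, ENNReal.ofReal (‖w‖ ^ 4) ∂(gaussMeasure u θb) with hm₄def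
  have hm₄top : m₄ ≠ ⊤ := lintegral_norm_pow_gaussMeasure_ne_top u θb (k := 4) (by norm_num)
  set m₄r : ℝ := m₄.toReal with hm₄rdef
  have hm₄r : 0 ≤ m₄r := ENNReal.toReal_nonneg
  have hm₄eq : m₄ = ENNReal.ofReal m₄r := (ENNReal.ofReal_toReal hm₄top).symm
  -- the thin shell: `η = 1/(n+1)` with `Θ(η) < cs √E gS / 32`
  have hlim := c5sd_tendsto_thinFlux u θb hE
  have htarget : (0 : ℝ≥0∞) < ENNReal.ofReal (cs * Real.sqrt E * gS / 32) :=
    ENNReal.ofReal_pos.2 (by positivity)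
  obtain ⟨n, hn⟩ := ((tendsto_order.1 hlim).2 _ htarget).exists
  set η : ℝ := 1 / ((n : ℝ) + 1) with hηdef
  have hη : 0 < η := by positivity
  -- the constants
  set κ₀ : ℝ := cs * Real.sqrt E * gS * (η * E ^ 2) / 2 with hκ₀def
  have hκ₀ : 0 < κ₀ := by positivity
  set c : ℝ := κ₀ / (m₄r + 1) with hcdef
  have hc : 0 < c := by positivity
  refine ⟨Real.sqrt E, Real.sqrt_nonneg E, c, hc, max N₃ 1, fun N hN s t hs hst => ?_⟩
  have hN₃ : N₃ ≤ N := le_of_max_le_left hN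
  have hN1 : 1 ≤ N := le_of_max_le_right hN
  rcases hst.eq_or_lt with heq | hlt
  · subst heq
    rw [Set.Ioc_self, setLIntegral_empty, mul_zero]
    exact zero_le
  -- abbreviations
  set τ : ℝ := t - s with hτdef
  have hτ : 0 < τ := sub_pos.2 hlt
  set ε : ℝ := hsDiameter σ N with hεdef
  have hε : 0 < ε := hsDiameter_pos hσ N
  set P := localGibbsLaw σ (fun _ => a) (fun _ => u) (fun _ => θb) N (Φ N) with hPdef
  have hgood := ae_mem_good_localGibbsLaw σ (fun _ => a) (fun _ => u) (fun _ => θb) N (Φ N)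
  set R : ℝ≥0∞ := ∫⁻ z, (Φ N).collisionPairSum (Ioc s t) (fun _ w i j =>
      if Real.sqrt E < ‖(collidePair (Torus.geometry (Fin 3)) i j w i).2‖ then
        ENNReal.ofReal (((N + 1 : ℕ) : ℝ)⁻¹ * (2 * (‖(w i).2‖ ^ 2 * ‖(w j).2‖ ^ 2))) else 0) z ∂P
    with hRdef
  set Y : ℝ := ((N + 1 : ℕ) : ℝ) * ε ^ 2 * τ with hYdef
  have hY : 0 ≤ Y := by positivity
  set X : ℝ := cs * Real.sqrt E * gS * ((N + 1 : ℕ) : ℝ) * Y with hXdef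
  have hX : 0 ≤ X := by positivity
  have hNr : ((N + 1 : ℕ) : ℝ) ≠ 0 := by positivity
  have hcast : ((N + 1 : ℕ) : ℝ) = (N : ℝ) + 1 := by push_cast; ring
  -- (T) the flux ceiling of the thin shell
  have hATm : Measurable ({p : V3 × V3 | E < ‖p.1‖ ^ 2 + ‖p.2‖ ^ 2 ∧
      ‖p.1‖ ^ 2 + ‖p.2‖ ^ 2 < (1 + η) * E}.indicator fun _ => (1 : ℝ≥0∞)) :=
    measurable_const.indicator (c5sd_measurableSet_thin E _)
  have hT := c5sd_lintegral_collisionPairSum_le hσ hsm ha hθ u hN1 (Φ N) hATm hlt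
  have hTX : (∫⁻ z, (Φ N).collisionPairSum (Ioc s t) (fun _ w i j =>
      {p : V3 × V3 | E < ‖p.1‖ ^ 2 + ‖p.2‖ ^ 2 ∧ ‖p.1‖ ^ 2 + ‖p.2‖ ^ 2 < (1 + η) * E}.indicator
        (fun _ => (1 : ℝ≥0∞)) ((w i).2, (w j).2)) z ∂P) ≤ ENNReal.ofReal (X / 2) := by
    refine hT.trans ((mul_le_mul_right hn.le _).trans_eq ?_)
    rw [← ENNReal.ofReal_mul (by positivity)]
    congr 1
    rw [hXdef, hYdef]
    ring
  -- (S) the splitting floor and the census at rung 0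
  have hS := hfloor N hN₃ s t hs hst E hEth
  rw [← succ_mul_hsDiameter_sq_eq_clock] at hS
  have hcensus : ((N + 1 : ℕ) : ℝ≥0∞) * γS ≤ ⨅ r ∈ Icc s t,
      shellCensus σ (fun _ => a) (fun _ => θb) (fun _ => u) N (Φ N) r E (3 / 2 * E) :=
    le_iInf₂ fun r _ => (shellCensus_const hσ2.le ha hθ u N (Φ N) r E (3 / 2 * E)).ge
  have hSX : ENNReal.ofReal X ≤
      eventCount σ (fun _ => a) (fun _ => θb) (fun _ => u) N (Φ N) s t (splitEvent E) := by
    calc ENNReal.ofReal X = ENNReal.ofReal (cs * (((N + 1 : ℕ) : ℝ) * ε ^ 2) * Real.sqrt E * τ) *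
          (((N + 1 : ℕ) : ℝ≥0∞) * γS) := by
          rw [hγSeq, ← ENNReal.ofReal_natCast, ← ENNReal.ofReal_mul (Nat.cast_nonneg _),
            ← ENNReal.ofReal_mul (by positivity)]
          congr 1
          rw [hXdef, hYdef]
          ring
      _ ≤ ENNReal.ofReal (cs * (((N + 1 : ℕ) : ℝ) * ε ^ 2) * Real.sqrt E * τ) *
          ⨅ r ∈ Icc s t, shellCensus σ (fun _ => a) (fun _ => θb) (fun _ => u) N (Φ N) r E (3 / 2 * E) :=
          mul_le_mul_right hcensus _
      _ ≤ _ := hS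
  -- (E) the pathwise comparison in expectation: `ofReal X ≤ ofReal (X/2) + C R`
  have hEv := c5qmf_eventCount_le hσ hσ2 (fun _ => a) (fun _ => θb) (fun _ => u) (Φ N) hE hη s t
  set C : ℝ≥0∞ := ENNReal.ofReal (((N + 1 : ℕ) : ℝ) / (η * E ^ 2)) with hCdef
  have hX2 : ENNReal.ofReal (X / 2) ≤ C * R := by
    have h1 : ENNReal.ofReal X ≤ ENNReal.ofReal (X / 2) + C * R :=
      hSX.trans (hEv.trans (add_le_add_left hTX _))
    have hsplit : ENNReal.ofReal X = ENNReal.ofReal (X / 2) + ENNReal.ofReal (X / 2) := by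
      rw [← ENNReal.ofReal_add (by positivity) (by positivity), add_halves]
    rw [hsplit] at h1
    exact (ENNReal.add_le_add_iff_left ENNReal.ofReal_ne_top).1 h1
  have hR : ENNReal.ofReal (κ₀ * Y) ≤ R := by
    have hprod : ENNReal.ofReal (η * E ^ 2 / ((N + 1 : ℕ) : ℝ)) * C = 1 := by
      rw [hCdef, ← ENNReal.ofReal_mul (by positivity), ← ENNReal.ofReal_one]
      congr 1
      field_simp
    calc ENNReal.ofReal (κ₀ * Y)
        = ENNReal.ofReal (η * E ^ 2 / ((N + 1 : ℕ) : ℝ)) * ENNReal.ofReal (X / 2) := by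
          rw [← ENNReal.ofReal_mul (by positivity)]
          congr 1
          rw [hκ₀def, hXdef]
          field_simp
      _ ≤ ENNReal.ofReal (η * E ^ 2 / ((N + 1 : ℕ) : ℝ)) * (C * R) := mul_le_mul_right hX2 _
      _ = R := by rw [← mul_assoc, hprod, one_mul]
  -- the right side of the stub is `R`, read on the routes' inline form
  have hRHS : R = ∫⁻ z, (∑ᶠ r ∈ collisionTimes (Torus.geometry (Fin 3)) (hsDiameter σ N)
        (fun r => (Φ N).flow r z) ∩ Set.Ioc s t,
      ∑ i : Fin (N + 1), ∑ j : Fin (N + 1), if i = j then (0 : ℝ≥0∞) else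
        (contactSet (Torus.geometry (Fin 3)) (N + 1) (hsDiameter σ N) i j).indicator
          (fun y => if Real.sqrt E < ‖((collidePair (Torus.geometry (Fin 3)) i j y) i).2‖ then
            ENNReal.ofReal (((N + 1 : ℕ) : ℝ)⁻¹ * (2 * (‖(y i).2‖ ^ 2 * ‖(y j).2‖ ^ 2))) else 0)
          ((Φ N).flow r z)) ∂P := by
    refine lintegral_congr_ae ?_
    filter_upwards [hgood] with z hz
    exact (c5sd_finsum_eq_collisionPairSum (Φ N) hz (Set.Ioc s t) (fun y i j =>
      if Real.sqrt E < ‖((collidePair (Torus.geometry (Fin 3)) i j y) i).2‖ then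
        ENNReal.ofReal (((N + 1 : ℕ) : ℝ)⁻¹ * (2 * (‖(y i).2‖ ^ 2 * ‖(y j).2‖ ^ 2))) else 0)).symm
  -- LEFT: the inner expectation is the constant Gaussian moment `m ≤ m₄`
  have hhm : Measurable fun w : V3 => if Real.sqrt E < ‖w‖ then ‖w‖ ^ 4 else 0 :=
    Measurable.ite (measurableSet_lt measurable_const measurable_norm) (measurable_norm.pow_const 4)
      measurable_const
  have hh0 : ∀ w : V3, 0 ≤ (if Real.sqrt E < ‖w‖ then ‖w‖ ^ 4 else 0) := fun w => by
    split_ifs <;> positivity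
  set m : ℝ≥0∞ := ∫⁻ w, ENNReal.ofReal (if Real.sqrt E < ‖w‖ then ‖w‖ ^ 4 else 0) ∂(gaussMeasure u θb)
    with hmdef
  have hinner : ∀ r : ℝ, (∫⁻ z, ENNReal.ofReal (((N + 1 : ℕ) : ℝ)⁻¹ *
      ∑ i : Fin (N + 1), (if Real.sqrt E < ‖((Φ N).flow r z i).2‖ then ‖((Φ N).flow r z i).2‖ ^ 4
        else 0)) ∂P) = m := by
    intro r
    rw [hcast]
    exact avgMoment_flow_localGibbsLaw_drift hσ2.le ha hθ u N (Φ N) r hhm hh0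
  have hm4 : m ≤ m₄ :=
    lintegral_mono fun w => ENNReal.ofReal_le_ofReal (by split_ifs <;> [exact le_rfl; positivity])
  have hLEFT : (∫⁻ r in Set.Ioc s t, (∫⁻ z, ENNReal.ofReal (((N + 1 : ℕ) : ℝ)⁻¹ *
      ∑ i : Fin (N + 1), (if Real.sqrt E < ‖((Φ N).flow r z i).2‖ then ‖((Φ N).flow r z i).2‖ ^ 4
        else 0)) ∂P)) ≤ m₄ * ENNReal.ofReal τ := by
    calc (∫⁻ r in Set.Ioc s t, (∫⁻ z, ENNReal.ofReal (((N + 1 : ℕ) : ℝ)⁻¹ *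
          ∑ i : Fin (N + 1), (if Real.sqrt E < ‖((Φ N).flow r z i).2‖ then ‖((Φ N).flow r z i).2‖ ^ 4
            else 0)) ∂P))
        = ∫⁻ _r in Set.Ioc s t, m := lintegral_congr fun r => hinner r
      _ = m * volume (Set.Ioc s t) := setLIntegral_const _ _
      _ = m * ENNReal.ofReal τ := by rw [Real.volume_Ioc]
      _ ≤ m₄ * ENNReal.ofReal τ := mul_le_mul' hm4 le_rfl
  -- constants
  have hclock : σ ^ 2 * ((N + 1 : ℕ) : ℝ) ^ ((1 : ℝ) / 3) = ((N + 1 : ℕ) : ℝ) * ε ^ 2 := by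
    rw [hεdef, succ_mul_hsDiameter_sq_eq_clock, clock, hcast]
  have hkey : c * m₄r ≤ κ₀ := by
    rw [hcdef, div_mul_eq_mul_div, div_le_iff₀ (by positivity)]
    exact mul_le_mul_of_nonneg_left (by linarith) hκ₀.le
  have hA0 : 0 ≤ c * (((N + 1 : ℕ) : ℝ) * ε ^ 2) := by positivity
  -- assemble
  calc ENNReal.ofReal (c * (σ ^ 2 * ((N + 1 : ℕ) : ℝ) ^ ((1 : ℝ) / 3))) * _
      ≤ ENNReal.ofReal (c * (σ ^ 2 * ((N + 1 : ℕ) : ℝ) ^ ((1 : ℝ) / 3))) * (m₄ * ENNReal.ofReal τ) :=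
        mul_le_mul' le_rfl hLEFT
    _ = ENNReal.ofReal (c * m₄r * Y) := by
        rw [hclock, hm₄eq, ← ENNReal.ofReal_mul hm₄r, ← ENNReal.ofReal_mul hA0]
        congr 1
        rw [hYdef]
        ring
    _ ≤ ENNReal.ofReal (κ₀ * Y) := ENNReal.ofReal_le_ofReal (mul_le_mul_of_nonneg_right hkey hY)
    _ ≤ R := hR
    _ = _ := hRHS

end Summit.AtomisticToContinuum.HydrodynamicLimit.Theorems.QuarticSchurLedger

end
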